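import Summits.Ventures.GridStability.Models.StructurePreservingInstance
import Summits.Ventures.GridStability.Models.StructurePreservingPhaseBridge

/-!
# GridStability/Models/WSCC9SP — the 9-node STRUCTURE-PRESERVING WSCC 3-machine instance «WSCC9-SP9»
# (post-fault network B, column V1), typed as the SP–Lur'e lane CANARY (lead ruling R-SP9,
# 2026-08-27T04:41:51Z: census / canary object, NOT OF RECORD)

LADDER-GRIDFUSION G2 «SP–Lur'e lane» canary / G3 register, seat gridfusion-model-2 (g6). MODEL-VALIDITY
row MV-3 with the instance tokens of plan/MODEL-VALIDITY.md v0.28 / R-SP9: «MV-3 + lossless +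
MV-RD(0.046 @ slack G1) + D⟨declared⟩ + V-frozen(V1) (all magnitudes ≡ 1) + 60-Hz base ω_R = 377
PRINTED [cite: AndersonFouad1977, §2.5] + ref bus 9 (Lur'e file; bookkeeping)»; MANDATORY LABEL:
«census / canary object of the SP–Lur'e lane — a structure-preserving VARIANT of the printed 9-bus
(no Kron reduction, loads as frequency-dependent injections at their buses, lossless lines, printed
losses 0.046 pu relocated to G1 by the lossless model), not a 9-bus sentence and not comparable
like-for-like with the MV-2 (Kron) kernel numbers of G1.b / G1-cct».

SOURCE OF EVERY NUMBER: `bench/data/WSCC9/sp9/sp9.json` sha16 `61008636cbb630ff` (model-4 g5, generator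
`build_wscc9_sp9.py` = the NE39/sp49 generator re-targeted; content version 2, lead ruling 02:26:41Z
folded), network «postB» (line 5–7 opened — the G1.b post-fault topology), built from
`bench/data/WSCC9/params.json` 02359175fbcb465d = [cite: AndersonFouad1977, Table 2.1, Table 2.2,
Ex. 2.6, Ex. 3.2] and [cite: SauerPai1998, Table 7.1] read on the page by model-4 (locators inside
params.json). This file was GENERATED from that JSON by `gen_wscc9sp.py` (model-2 g6 session folder,
staged HOME/lean/model-2/) — no literal typed by hand. (a) nodes `0..5` = HV buses 4..9, `6, 7, 8` =
internal nodes of machines G1, G2, G3 behind `x′_d + x_t` on buses 4, 7, 9 (terminal buses 1–3 carry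
no load and are eliminated by series combination as in Table 2.2 — MODELLED, MV-3 (b)/(e): transit
buses), generator set `gen = {6, 7, 8}`; (b) 8 coupled pairs `(src e, tgt e)`, `src < tgt` (a TREE: the
post-B network has no cycle), couplings column «V1» `bᵢⱼ = 1/xᵢⱼ` (all magnitudes ≡ 1, the
as-printed-assumption column — OF RECORD for the canary per MODEL-VALIDITY v0.28) and column «LF»
`bᵢⱼ = VᵢVⱼ/xᵢⱼ` (printed PRE-fault load-flow magnitudes frozen; internal `Eᵢ` of Ex. 2.6) typed
alongside as sibling data; (c) equilibrium eq=b: rational half-angle tangents `tᵢ` (denominators ≤ 10⁶)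
re-solved for the PRINTED injections on the lossless post-B network, `δ₀ᵢ = 2·arctan tᵢ`, injected
powers DEFINED as `P⁰ := f(δ₀)` (exact; max |P′ − P_printed| = 9.2e-11 off the slack, slack G1
−0.046 pu = the printed LOSSES relocated by the lossless model — token MV-RD(0.046 @ slack G1),
VALIDATED numbers, model-4 (g)); (d) spanning tree = BFS from G1 (idx 6); (e) column V1: `τ_max =
9036854053/59450052158` (edge G2 – bus 7; `θ = 2·arctan τ_max ≈ 17.29°`), `β = 10000/2399` (G3 – bus 9);
column LF: `τ_max = 9278643981/65986701091`, `β = 262386/59975`; (f) `Mₖ = 2Hₖ/ω_R` with the printed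
`H = 23.64, 6.4, 3.01 s` and `ω_R = 377 rad/s` PRINTED; (g) DAMPING: no printed `Dᵢ` (A&F Table 2.1 prints
none; MODEL-VALIDITY Q-MV-3), so `D` is a PARAMETER of `params` — every statement below holds for ALL
`D > 0`; a Lur'e certificate (file `WSCC9SPLurie.lean`) is for a DECLARED `D`.

WHAT IS PROVED (pattern of `NE39SP.lean`, p480737): `wellFormed`, `b_symm`, `b_nonneg`, `edge_lower`,
`preconnected` (parent-pointer witness, `decide`), `window` (`|δ₀ᵢ − δ₀ⱼ| ≤ θ` on coupled pairs, 8
rational checks), `theta_bounds` (`0 ≤ θ < π/2`), `isSyncEquilibrium`, `syncFreq_eq_zero`, and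
the MV-3 energy-route certificate modulo the level `roa_of_lt_levelBound` (free by-product; no rung).
THREE COLUMNS: CERTIFIED = the statements below for MODEL M′; MODELLED = the tokens above; VALIDATED =
(g) and every printed CCT / Kron-model number of the 9-bus [cite: AndersonFouad1977, Ex. 2.6–2.7].
Nothing here says the WSCC system is stable.
-/

noncomputable section

open Finset Real Set Filter Topology

namespace Summit.Ventures.GridStability.Models.WSCC9SP

open StructurePreserving StructurePreserving.Params

/-! ## Data (generated from sp9.json 61008636cbb630ff, network postB) -/

/-- Edge sources (8 coupled pairs, `src < tgt`; node order of block (a):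
0 = bus 4, 1 = bus 5, 2 = bus 6, 3 = bus 7, 4 = bus 8, 5 = bus 9, 6 = G1, 7 = G2, 8 = G3). -/
def srcV : Fin 8 → Fin 9 :=
  ![0, 0, 0, 2, 3, 3, 4, 5]

/-- Edge targets. -/
def tgtV : Fin 8 → Fin 9 :=
  ![1, 2, 6, 5, 4, 7, 5, 8]

/-- Branch reactances `xᵢⱼ` (pu; lines: A&F Table 2.2 with R dropped; generator links: `x′_d + x_t`;
provenance only). -/
def xQ : Fin 8 → ℚ :=
  ![17/200, 23/250, 74/625, 17/100, 9/125, 1823/10000, 63/625, 2399/10000]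

/-- Column V1 couplings `bᵢⱼ = 1/xᵢⱼ` (all magnitudes ≡ 1) — the column OF RECORD for the canary. -/
def wtV1Q : Fin 8 → ℚ :=
  ![200/17, 250/23, 625/74, 100/17, 125/9, 10000/1823, 625/63, 10000/2399]

/-- Column LF couplings `bᵢⱼ = VᵢVⱼ/xᵢⱼ` (printed pre-fault load-flow magnitudes; sibling data). -/
def wtLFQ : Fin 8 → ℚ :=
  ![127737/10625, 519669/46000, 2710179/296000, 130677/21250, 7239/500, 2693763/455750, 5461/525,
    262386/59975]

/-- Column V1 half-angle tangents `tᵢ = tan(δ₀ᵢ/2)` (node order; G1 = reference, `t = 0`). -/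
def tV1Q : Fin 9 → ℚ :=
  ![-31101/782876, -48453/519884, -12769/981191, 12282/59147, 122757/835243, 22281/194336, 0,
    346559/933160, 118642/538561]

/-- Column LF half-angle tangents (sibling data). -/
def tLFQ : Fin 9 → ℚ :=
  ![-26047/710946, -10091/113465, -10228/934945, 104405/522279, 130976/923473, 107019/963773, 0,
    41369/118074, 109523/518027]

/-- Inertia constants `Mᵢ = 2Hᵢ/ω_R` (`ω_R = 377` printed), zero at the six buses. -/
def MQ : Fin 9 → ℚ :=
  ![0, 0, 0, 0, 0, 0, 1182/9425, 64/1885, 301/18850]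

/-- Generator internal nodes `{6, 7, 8}`. -/
def genS : Finset (Fin 9) := {6, 7, 8}

/-- BFS spanning tree from G1 (idx 6): parent array (`parent root = root`). -/
def parentV : Fin 9 → Fin 9 :=
  ![6, 0, 0, 4, 5, 2, 6, 3, 5]

/-- BFS depths. -/
def depthV : Fin 9 → ℕ :=
  ![1, 2, 2, 5, 4, 3, 0, 6, 4]

/-- For each node, the index of the listed edge joining it to its parent (root: arbitrary). -/
def treeEdge : Fin 9 → Fin 8 :=
  ![2, 0, 1, 4, 6, 3, 0, 5, 7]

/-- `τ_max` of column V1 (attained at G2 – bus 7). -/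
def tauV1 : ℚ := 9036854053/59450052158

/-- `β` = minimal coupling of column V1 (G3 – bus 9, `x′_d3 + x_t3 = 2399/10000`). -/
def betaV1 : ℚ := 10000/2399

/-- `τ_max` of column LF. -/
def tauLF : ℚ := 9278643981/65986701091

/-- `β` of column LF. -/
def betaLF : ℚ := 262386/59975


/-! ## The instance (network post-B, column V1), parametrised by the damping vector `D` -/

/-- Real edge weights of column V1. -/
def wt : Fin 8 → ℝ := fun e => (wtV1Q e : ℝ)

/-- Real half-angle tangents of column V1. -/
def t : Fin 9 → ℝ := fun i => (tV1Q i : ℝ)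

/-- Couplings `b = symmetrize (edgeWeight src tgt wt)` (column V1). -/
def b : Fin 9 → Fin 9 → ℝ := symmetrize (edgeWeight srcV tgtV wt)

/-- The eq=b equilibrium angles `δ₀ᵢ = 2·arctan tᵢ`. -/
def δ₀ : Fin 9 → ℝ := halfAngle t

/-- Window level `θ = 2·arctan τ_max`. -/
def θ : ℝ := 2 * Real.arctan (tauV1 : ℝ)

/-- The WSCC9-SP9 data (post-B, V1) as structure-preserving `Params`, for a damping / load-frequency
vector `D` (a PARAMETER: no printed values exist); injected powers DEFINED as `P⁰ := f(δ₀)` (eq=b;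
MV-RD(0.046 @ slack G1)). -/
def params (D : Fin 9 → ℝ) : Params 9 where
  M := fun i => (MQ i : ℝ)
  D := D
  P0 := Params.pe ⟨fun i => (MQ i : ℝ), D, 0, b, genS⟩ δ₀
  b := b
  gen := genS

/-- Unfolding: the couplings of `params D`. -/
theorem params_b (D : Fin 9 → ℝ) : (params D).b = b := rfl

/-- Unfolding: `P⁰ = f(δ₀)` for `params D` (`pe` only reads `b`). -/
theorem params_P0 (D : Fin 9 → ℝ) : (params D).P0 = (params D).pe δ₀ := rfl

/-- Every listed V1 weight is at least `β` (8 rational checks). -/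
theorem wt_ge_beta : ∀ e, (betaV1 : ℝ) ≤ wt e := by
  intro e
  unfold wt
  exact_mod_cast (show betaV1 ≤ wtV1Q e by fin_cases e <;> simp [betaV1, wtV1Q] <;> norm_num)

/-- `β > 0`. -/
theorem beta_pos : (0 : ℝ) < (betaV1 : ℝ) := by
  exact_mod_cast (show (0 : ℚ) < betaV1 by norm_num [betaV1])

/-- Every listed weight is nonnegative. -/
theorem wt_nonneg : ∀ e, 0 ≤ wt e := fun e => beta_pos.le.trans (wt_ge_beta e)

/-- Every listed weight is positive. -/
theorem wt_pos : ∀ e, 0 < wt e := fun e => beta_pos.trans_le (wt_ge_beta e)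

/-- The couplings are symmetric. -/
theorem b_symm (i j : Fin 9) : b i j = b j i := symmetrize_symm _ i j

/-- The couplings are nonnegative. -/
theorem b_nonneg (i j : Fin 9) : 0 ≤ b i j := symmetrize_nonneg (edgeWeight_nonneg wt_nonneg) i j

/-- **Well-formedness** (printed sign pattern): `Mᵢ > 0` exactly on the internal nodes, `0` on the
buses; `Dᵢ > 0` is the hypothesis on the parameter; `b` symmetric. -/
theorem wellFormed {D : Fin 9 → ℝ} (hD : ∀ i, 0 < D i) : (params D).WellFormed where
  M_pos := by
    intro i hi
    change 0 < ((MQ i : ℚ) : ℝ)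
    have : (0 : ℚ) < MQ i := by
      simp only [params, genS, Finset.mem_insert, Finset.mem_singleton] at hi
      rcases hi with h | h | h <;> (subst h; simp [MQ])
    exact_mod_cast this
  M_eq_zero := by
    intro i hi
    change ((MQ i : ℚ) : ℝ) = 0
    have : MQ i = 0 := by
      fin_cases i <;> simp_all [params, genS, MQ]
    rw [this]; norm_num
  D_pos := hD
  b_symm := b_symm

/-- **Connectivity**: the BFS tree (parent array, depths) is a parent-pointer spanning tree of the
coupling graph (9 `decide` checks + positivity of the tree edges' weights). -/
theorem preconnected (D : Fin 9 → ℝ) : (params D).couplingGraph.Preconnected := by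
  refine (params D).couplingGraph_preconnected_of_parent b_symm 6 parentV depthV ?_ ?_ ?_
  · exact fun v hv => (by decide : ∀ v : Fin 9, v ≠ 6 → parentV v ≠ v) v hv
  · intro v hv
    rw [params_b]
    refine symmetrize_edgeWeight_ne_zero_of_edge wt_nonneg (treeEdge v) (wt_pos _) ?_
    exact (by decide : ∀ v : Fin 9, v ≠ 6 →
      (srcV (treeEdge v) = parentV v ∧ tgtV (treeEdge v) = v)
        ∨ (srcV (treeEdge v) = v ∧ tgtV (treeEdge v) = parentV v)) v hv
  · exact fun v hv => (by decide : ∀ v : Fin 9, v ≠ 6 → depthV (parentV v) < depthV v) v hv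

/-- **Uniform coupling lower bound on coupled pairs**: `β ≤ bᵢⱼ` whenever `i ~ j`. -/
theorem edge_lower (D : Fin 9 → ℝ) :
    ∀ i j, (params D).couplingGraph.Adj i j → (betaV1 : ℝ) ≤ (params D).b i j := by
  intro i j hij
  rw [params_b]
  have hne : b i j ≠ 0 := (((params D).couplingGraph_adj_of_symm b_symm i j).mp hij).2
  exact le_symmetrize_of_ne_zero wt_nonneg wt_ge_beta hne

/-- **The window datum**: every coupled pair has `|δ₀ᵢ − δ₀ⱼ| ≤ θ = 2·arctan τ_max`
(8 rational checks `tᵢtⱼ > −1`, `|(tᵢ − tⱼ)/(1 + tᵢtⱼ)| ≤ τ_max`). -/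
theorem window (D : Fin 9 → ℝ) : ∀ i j, (params D).b i j ≠ 0 → |δ₀ i - δ₀ j| ≤ θ := by
  intro i j hij
  rw [params_b] at hij
  refine window_of_edgeChecks (src := srcV) (tgt := tgtV) (wt := wt) ?_ ?_ hij
  · intro e
    have h : (-1 : ℚ) < tV1Q (srcV e) * tV1Q (tgtV e) := by
      fin_cases e <;> simp [tV1Q, srcV, tgtV] <;> norm_num
    unfold t; exact_mod_cast h
  · intro e
    have h : |(tV1Q (srcV e) - tV1Q (tgtV e)) / (1 + tV1Q (srcV e) * tV1Q (tgtV e))| ≤ tauV1 := by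
      fin_cases e <;> simp [tV1Q, srcV, tgtV, tauV1, abs_le] <;> norm_num
    unfold t; exact_mod_cast h

/-- **Window bounds** `0 ≤ θ < π/2` — i.e. `0 ≤ τ_max < 1` (largest post-B branch angle ≈ 17.3°);
one conjunction (the two halves are `theta_bounds.1` / `.2`). -/
theorem theta_bounds : 0 ≤ θ ∧ θ < π / 2 :=
  ⟨Lyapunov.StructurePreserving.two_mul_arctan_nonneg
      (by exact_mod_cast (show (0 : ℚ) ≤ tauV1 by norm_num [tauV1])),
    Lyapunov.StructurePreserving.two_mul_arctan_lt_pi_div_two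
      (by exact_mod_cast (show tauV1 < 1 by norm_num [tauV1]))⟩

/-- **`δ₀` is a synchronous equilibrium** of `params D` for EVERY `D` (`P⁰ := f(δ₀)`, `Σ P⁰ = 0`,
`ω₀ = 0`). -/
theorem isSyncEquilibrium (D : Fin 9 → ℝ) : (params D).IsSyncEquilibrium δ₀ :=
  (params D).isSyncEquilibrium_of_P0_eq_pe b_symm (params_P0 D)

/-- `ω₀ = 0` for this instance (the shifted model IS the model). -/
theorem syncFreq_eq_zero (D : Fin 9 → ℝ) : (params D).syncFreq = 0 :=
  (params D).syncFreq_eq_zero_of_P0_eq_pe b_symm (params_P0 D)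

/-- **MV-3 ENERGY-ROUTE CERTIFICATE MODULO THE LEVEL** (region-of-attraction theorem of record, lyap-1
p475989 / model-2 p480456, instantiated on «WSCC9-SP9» post-B V1; a free by-product of the typing, no
rung): for every `D > 0` and every level `c < g(θ)·β·(π/2 − θ)²/4`, `g(θ) = (1 − sin θ)/(π/2 − θ)`:
from every phase point of `S_c = {V(δ₀; ·) ≤ c} ∩ window ∩ {L = L(δ₀, 0), ω_bus = 0}` a global solution
of the structure-preserving field exists and EVERY global solution from it stays in `S_c` and tends to
`(δ₀, 0)`. CERTIFIED for MODEL M′ only (tokens in the header). -/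
theorem roa_of_lt_levelBound {D : Fin 9 → ℝ} (hD : ∀ i, 0 < D i) {c : ℝ}
    (hc : c < (1 - Real.sin θ) / (π / 2 - θ) * (betaV1 : ℝ) * (π / 2 - θ) ^ 2 / 4)
    {y : (Fin 9 → ℝ) × (Fin 9 → ℝ)}
    (hy : y ∈ (params D).window ∩ (params D).constraintSet δ₀ ∧ (params D).energy δ₀ y.1 y.2 ≤ c) :
    (∃ X : ℝ → (Fin 9 → ℝ) × (Fin 9 → ℝ), X 0 = y ∧
      ∀ T : ℝ, ∀ s ∈ Icc 0 T,
        HasDerivWithinAt X ((params D).shifted.phaseField (X s)) (Icc 0 T) s) ∧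
    ∀ X : ℝ → (Fin 9 → ℝ) × (Fin 9 → ℝ), X 0 = y →
      (∀ T : ℝ, ∀ s ∈ Icc 0 T,
        HasDerivWithinAt X ((params D).shifted.phaseField (X s)) (Icc 0 T) s) →
      (∀ s, 0 ≤ s → X s ∈ (params D).window ∩ (params D).constraintSet δ₀ ∧
        (params D).energy δ₀ (X s).1 (X s).2 ≤ c) ∧ Tendsto X atTop (𝓝 (δ₀, 0)) :=
  (params D).energySublevel_subset_regionOfAttraction (wellFormed hD) (by decide) (preconnected D)
    (fun i j => by rw [params_b]; exact b_nonneg i j) beta_pos (edge_lower D) theta_bounds.1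
    theta_bounds.2 (window D) (isSyncEquilibrium D) hc hy

end Summit.Ventures.GridStability.Models.WSCC9SP

end
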